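import Summits.BirchSwinnertonDyer.BirchSwinnertonDyer.Theorems.ClassRecordThreeHalvesAtThreeValueContinuityB
import HarnessLib

/-!
# Route `KolyvaginRoadThree`, crux `HalvesTamAtThree` (item 19155) ∕ H3 child 19506 — the children glue with the
# ORIENTATION-REPAIRED H3 atom `Three.IMCDivAt₃B`: (VC₃) ∧ «IMCDivTwoLociTamAtThreeR» ⟹ «HalvesTamAtThreeR»
# (plan g30 RULING 2 (G4); ORIENT-AUDIT-19270 form (a) at `p = 3`)

Cell `bsd-stepL` (run/shared/lean/pub/bsd-stepL/), seat `bsd-stepL-bdp` (prover g16, 2026-08-27; fallback hand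
for (G4)). `--supports stmt-BirchSwinnertonDyer-19506 --as helper`. Koly twin of
`Theorems/ClassRecordThreeHalvesAtThreeValueContinuityB.lean`, exactly as thmc-p1's
`kolyvaginRoadThree_halvesTamAtThree_of_valueContinuity_of_imcDivTamStub` (p422252) twins p421546: the extra binder
`3 ∣ ∏ c_ℓ` on the (ram) ∧ 3-split locus. As there, the conclusion is the REPAIRED PARENT BODY «HalvesTamAtThreeR»
:= `∀ W, ClassX11b W 3 → (Ram → 3 split → 3 ∣ ∏c → BDPValueAt₃ W ∧ IMCDivAt₃B W) ∧ (¬Ram → Surj → BDPValueAt₃ W ∧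
IMCDivAt₃B W)` — the registered `HalvesTamAtThree` carries the A-atom and is not derivable from the B-atom; the
KOLY `closes` re-certifies through `multiplicativeRankOneAtThree_of_kolyRecord_upperB`
(`Theorems/ClassRecordThreeKernelUpperB.lean`).

* **`kolyvaginRoadThree_halvesTamAtThree_of_valueContinuity_of_imcDivTamStubB`** — (VC₃) for every curve ∧ the
  R-child body with the Tamagawa binder ⟹ the R-parent body.
* `kolyvaginRoadThree_halvesTamAtThree_of_valueContinuity_of_imcDivStubB` — the same from ClassRecordThree's
  R-child body (no Tamagawa binder), a fortiori.

HONEST FRAMING: implications only; (VC₃) and H3ᴮ are hypotheses, OPEN at `3 ∥ N`; nothing is discharged,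
booked or re-labelled (T7); O2 stays OPEN; BSD(E,3) is proved for no class.
References: [Castella2018] Thm. 3.2, Thm. 3.3 (arXiv:1704.06608 p. 9); cell audit ORIENT-AUDIT-19270 Q4 (a).
-/

noncomputable section

open scoped Classical Topology

open Filter WeierstrassCurve NumberField IsDedekindDomain Field PowerSeries
  Literature.NumberTheory.EllipticCurves Literature.NumberTheory.EllipticCurves.ModularForms
  Literature.NumberTheory.EllipticCurves.Rank1Residual
  Literature.NumberTheory.GaloisRepresentations Literature.NumberTheory.GaloisCohomology
  Summit.BirchSwinnertonDyer.Rank1Residual Summit.BirchSwinnertonDyer.Rank1Residual.X11b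
  Summit.BirchSwinnertonDyer.Rank1Residual.X11b.AcSelmer
  Summit.BirchSwinnertonDyer.Rank1Residual.X11b.CongruenceLimit
  Summit.BirchSwinnertonDyer.Rank1Residual.X11b.Halves
  Summit.BirchSwinnertonDyer.Rank1Residual.X11b.Three

-- the cell's Theorems namespace repeats the summit name (Summit.<Summit>.<Problem>), as in every sibling file
set_option linter.dupNamespace false

namespace Summit.BirchSwinnertonDyer.BirchSwinnertonDyer.Theorems

/-- **(VC₃) for every curve ∧ the ORIENTED two-loci H3 WITH the Tamagawa binder ⟹ «HalvesTamAtThreeR»**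
((ram) → 3 split → 3 ∣ ∏c → `BDPValueAt₃ W ∧ IMCDivAt₃B W`; ¬(ram) → surj → the same). Twin of
`kolyvaginRoadThree_halvesTamAtThree_of_valueContinuity_of_imcDivTamStub` (p422252). CONDITIONAL on both hypotheses.
[cite: Castella2018, Thm. 3.2 and Thm. 3.3 (arXiv:1704.06608 p. 9) (shapes only; both halves open at p = 3)] -/
theorem kolyvaginRoadThree_halvesTamAtThree_of_valueContinuity_of_imcDivTamStubB
    (hVC : ∀ (W : WeierstrassCurve ℚ) [W.IsElliptic] [W.IsGloballyMinimal],
      ∀ (N : ℕ) [NeZero N] (K : Type) [Field K] [NumberField K] (Dt : ModularParametrizationData W N)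
      (H : HeegnerDatum N (NumberField.discr K)) (ι : K →+* ℂ) (P : (W.baseChange K).toAffine.Point),
      ClassX11b W 3 → Surj W 3 → W.conductorNorm ℤ = N → IsImaginaryQuadratic K →
      Odd (NumberField.discr K) → SatisfiesHeegnerHypothesis N K →
      (W.quadraticTwist (NumberField.discr K : ℚ)).entireLFunction 1 ≠ 0 →
      WeierstrassCurve.Affine.Point.map ι.toRatAlgHom P = heegnerPointComplex Dt H →
      ¬ (3 : ℤ) ∣ Dt.c → ¬ IsOfFinAddOrder P →
      ∀ (κ : ZpExtension K 3), κ.IsAnticyclotomic →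
        ∀ (γ : Field.absoluteGaloisGroup K) [Fact (κ.IsTopGenerator γ)]
          (𝔭 : HeightOneSpectrum (𝓞 K)) (h𝔭 : ((3 : ℕ) : 𝓞 K) ∈ 𝔭.asIdeal)
          (he : 𝔭.asIdeal.ramificationIdx (𝓞 ℚ) = 1) (hf : 𝔭.asIdeal.inertiaDeg (𝓞 ℚ) = 1),
          ∀ (f : CuspForm (CongruenceSubgroup.Gamma0 N) 2), IsNewformOf W f →
            ∀ (ι' : PadicAlgCl 3 ≃+* ℂ), InducesPrime ι' 𝔭 →
              ∃ (ΩK : ℂ) (Ωp : ℂ_[3]) (u : (unrIntegers 3)ˣ), ΩK ≠ 0 ∧ Ωp ≠ 0 ∧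
                ∀ (φ : ℕ → HeckeCharacter K) (n : ℕ → ℕ) (r : ℕ → FramedGaloisRep K (PadicAlgCl 3) 1),
                  (∀ k, 0 < n k) → (∀ k (v : HeightOneSpectrum (𝓞 K)), (φ k).IsUnramifiedAt v) →
                  (∀ k, (φ k).HasInfinityType (fun _ ↦ (n k : ℤ)) (fun _ ↦ -(n k : ℤ))) →
                  (∀ k, IsPAdicAvatarOf ι' (φ k) (r k)) → (∀ k, FactorsThroughZp κ (r k)) →
                  Tendsto (fun k ↦ avatarValueAt (r k) γ) atTop (𝓝 1) →
                  Tendsto (fun k ↦ ((ι'.symm (bdpInterpolationValue 3 f 𝔭 (φ k) (n k) ΩK) :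
                    PadicAlgCl 3) : ℂ_[3]) * Ωp ^ (4 * n k)) atTop
                    (𝓝 (((u : unrIntegers 3) : ℂ_[3]) *
                      (algebraMap ℚ_[3] ℂ_[3] (((1 : ℚ_[3]) - ((W.LFunction 3 : ℤ) : ℚ_[3]) *
                        (3 : ℚ_[3])⁻¹) * logOmega W 3 (embAt K 3 𝔭 h𝔭 he hf) P)) ^ 2)))
    (h3 : ∀ (W : WeierstrassCurve ℚ) [W.IsElliptic] [W.IsGloballyMinimal], ClassX11b W 3 →
      (Ram W 3 → W.HasSplitMultiplicativeReductionAtPrime 3 → 3 ∣ W.tamagawaProduct → IMCDivAt₃B W) ∧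
        (¬ Ram W 3 → Surj W 3 → IMCDivAt₃B W)) :
    ∀ (W : WeierstrassCurve ℚ) [W.IsElliptic] [W.IsGloballyMinimal],
      Summit.BirchSwinnertonDyer.Rank1Residual.ClassX11b W 3 →
        (Literature.NumberTheory.EllipticCurves.Rank1Residual.Ram W 3 →
            W.HasSplitMultiplicativeReductionAtPrime 3 → 3 ∣ W.tamagawaProduct →
              Summit.BirchSwinnertonDyer.Rank1Residual.X11b.Three.BDPValueAt₃ W ∧
                Summit.BirchSwinnertonDyer.Rank1Residual.X11b.Three.IMCDivAt₃B W) ∧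
          (¬ Literature.NumberTheory.EllipticCurves.Rank1Residual.Ram W 3 →
            Literature.NumberTheory.EllipticCurves.Rank1Residual.Surj W 3 →
              Summit.BirchSwinnertonDyer.Rank1Residual.X11b.Three.BDPValueAt₃ W ∧
                Summit.BirchSwinnertonDyer.Rank1Residual.X11b.Three.IMCDivAt₃B W) := by
  intro W _ _ hX
  obtain ⟨hI₁, hI₂⟩ := h3 W hX
  exact ⟨fun hr hs ht ↦ ⟨bdpValueAt₃_of_valueContinuity (hVC W), hI₁ hr hs ht⟩,
    fun hnr hsu ↦ ⟨bdpValueAt₃_of_valueContinuity (hVC W), hI₂ hnr hsu⟩⟩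

/-- The same from ClassRecordThree's ORIENTED two-loci H3 WITHOUT the Tamagawa binder (a fortiori), through
`classRecordThree_halvesAtThree_of_valueContinuity_of_imcDivStubB`. [folklore] -/
theorem kolyvaginRoadThree_halvesTamAtThree_of_valueContinuity_of_imcDivStubB
    (hVC : ∀ (W : WeierstrassCurve ℚ) [W.IsElliptic] [W.IsGloballyMinimal],
      ∀ (N : ℕ) [NeZero N] (K : Type) [Field K] [NumberField K] (Dt : ModularParametrizationData W N)
      (H : HeegnerDatum N (NumberField.discr K)) (ι : K →+* ℂ) (P : (W.baseChange K).toAffine.Point),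
      ClassX11b W 3 → Surj W 3 → W.conductorNorm ℤ = N → IsImaginaryQuadratic K →
      Odd (NumberField.discr K) → SatisfiesHeegnerHypothesis N K →
      (W.quadraticTwist (NumberField.discr K : ℚ)).entireLFunction 1 ≠ 0 →
      WeierstrassCurve.Affine.Point.map ι.toRatAlgHom P = heegnerPointComplex Dt H →
      ¬ (3 : ℤ) ∣ Dt.c → ¬ IsOfFinAddOrder P →
      ∀ (κ : ZpExtension K 3), κ.IsAnticyclotomic →
        ∀ (γ : Field.absoluteGaloisGroup K) [Fact (κ.IsTopGenerator γ)]
          (𝔭 : HeightOneSpectrum (𝓞 K)) (h𝔭 : ((3 : ℕ) : 𝓞 K) ∈ 𝔭.asIdeal)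
          (he : 𝔭.asIdeal.ramificationIdx (𝓞 ℚ) = 1) (hf : 𝔭.asIdeal.inertiaDeg (𝓞 ℚ) = 1),
          ∀ (f : CuspForm (CongruenceSubgroup.Gamma0 N) 2), IsNewformOf W f →
            ∀ (ι' : PadicAlgCl 3 ≃+* ℂ), InducesPrime ι' 𝔭 →
              ∃ (ΩK : ℂ) (Ωp : ℂ_[3]) (u : (unrIntegers 3)ˣ), ΩK ≠ 0 ∧ Ωp ≠ 0 ∧
                ∀ (φ : ℕ → HeckeCharacter K) (n : ℕ → ℕ) (r : ℕ → FramedGaloisRep K (PadicAlgCl 3) 1),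
                  (∀ k, 0 < n k) → (∀ k (v : HeightOneSpectrum (𝓞 K)), (φ k).IsUnramifiedAt v) →
                  (∀ k, (φ k).HasInfinityType (fun _ ↦ (n k : ℤ)) (fun _ ↦ -(n k : ℤ))) →
                  (∀ k, IsPAdicAvatarOf ι' (φ k) (r k)) → (∀ k, FactorsThroughZp κ (r k)) →
                  Tendsto (fun k ↦ avatarValueAt (r k) γ) atTop (𝓝 1) →
                  Tendsto (fun k ↦ ((ι'.symm (bdpInterpolationValue 3 f 𝔭 (φ k) (n k) ΩK) :
                    PadicAlgCl 3) : ℂ_[3]) * Ωp ^ (4 * n k)) atTop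
                    (𝓝 (((u : unrIntegers 3) : ℂ_[3]) *
                      (algebraMap ℚ_[3] ℂ_[3] (((1 : ℚ_[3]) - ((W.LFunction 3 : ℤ) : ℚ_[3]) *
                        (3 : ℚ_[3])⁻¹) * logOmega W 3 (embAt K 3 𝔭 h𝔭 he hf) P)) ^ 2)))
    (h3 : ∀ (W : WeierstrassCurve ℚ) [W.IsElliptic] [W.IsGloballyMinimal], ClassX11b W 3 →
      (Ram W 3 → W.HasSplitMultiplicativeReductionAtPrime 3 → IMCDivAt₃B W) ∧
        (¬ Ram W 3 → Surj W 3 → IMCDivAt₃B W)) :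
    ∀ (W : WeierstrassCurve ℚ) [W.IsElliptic] [W.IsGloballyMinimal],
      Summit.BirchSwinnertonDyer.Rank1Residual.ClassX11b W 3 →
        (Literature.NumberTheory.EllipticCurves.Rank1Residual.Ram W 3 →
            W.HasSplitMultiplicativeReductionAtPrime 3 → 3 ∣ W.tamagawaProduct →
              Summit.BirchSwinnertonDyer.Rank1Residual.X11b.Three.BDPValueAt₃ W ∧
                Summit.BirchSwinnertonDyer.Rank1Residual.X11b.Three.IMCDivAt₃B W) ∧
          (¬ Literature.NumberTheory.EllipticCurves.Rank1Residual.Ram W 3 →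
            Literature.NumberTheory.EllipticCurves.Rank1Residual.Surj W 3 →
              Summit.BirchSwinnertonDyer.Rank1Residual.X11b.Three.BDPValueAt₃ W ∧
                Summit.BirchSwinnertonDyer.Rank1Residual.X11b.Three.IMCDivAt₃B W) := by
  intro W _ _ hX
  obtain ⟨hI₁, hI₂⟩ := classRecordThree_halvesAtThree_of_valueContinuity_of_imcDivStubB hVC h3 W hX
  exact ⟨fun hr hs _ ↦ hI₁ hr hs, hI₂⟩

end Summit.BirchSwinnertonDyer.BirchSwinnertonDyer.Theorems

end
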